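/-
# Solo-blind programme on Kontsevich–Zagier, s6 part T4c: the five-term relation, III — second cut

Third step of the five-term relation inside KZ's rules (`SoloBlindFiveTermWedge`, `…Xi`).
With `f = y ⋆ x = y(1−x)/(1−xy) < y` the lines `t₀ = f`, `t₁ = f` dissect the triangle of `D(y)`
into the triangle of `D(y ⋆ x)`, the rectangle `M = (f, y) × (0, f)` and the upper triangle
`T = {f < t₁ < t₀ < y}` (rule 1a, `dilogCut_dissect_twist`), and the affine chart of
`SoloBlindDilogEuler` maps `M` onto the logarithmic box of `y/f = (1−xy)/(1−x)` and
`1/(1−f) = (1−xy)/(1−y)` (rule 2), so that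

  `[M] = ℓ((1−xy)/(1−x)) · ℓ((1−xy)/(1−y))`   in `Q`   (`mkQ_midRep`).

The last file `SoloBlindFiveTerm` identifies `[T]` with the wedge class `[V, θ]` and assembles.
-/
import Summits.KontsevichZagierPeriods.KontsevichZagierPeriods.Theorems.SoloBlindFiveTermXi
import Summits.KontsevichZagierPeriods.KontsevichZagierPeriods.Theorems.SoloBlindDilogEuler

noncomputable section

open MeasureTheory Set MvPolynomial
open Literature.NumberTheory.Transcendental
open Literature.NumberTheory.Transcendental.KZ
open Literature.NumberTheory.Transcendental.KZ.IntegralRep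
open Literature.ModelTheory.ExponentialFields (IsSemialgebraic isSemialgebraic_setOf_eval_pos)

namespace Summit.KontsevichZagierPeriods.KontsevichZagierPeriods.Theorems

namespace SoloBlind

/-! ## The twisted cut `y ⋆ x` lies below `y` -/

variable (a c : Cut)

/-- `y ⋆ x < y`. -/
theorem Cut.twist_lt : (c.twist a).x < c.x := by
  rw [Cut.twist_x, mul_inv_lt_iff₀ (c.twistDen_pos a)]
  nlinarith [mul_pos (mul_pos c.pos a.pos) c.symm_pos]

/-! ## The three pieces of `D(y)` cut at `f = y ⋆ x` -/

/-- The upper triangle `T = {f < t₁ < t₀ < y}`. -/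
def hiDom : Set (Fin 2 → ℝ) := {t | (c.twist a).x < t 1 ∧ t 1 < t 0 ∧ t 0 < c.x}

/-- The rectangle `M = {0 < t₁ < f, f < t₀ < y}`. -/
def midRect : Set (Fin 2 → ℝ) :=
  {t | 0 < t 1 ∧ t 1 < (c.twist a).x ∧ (c.twist a).x < t 0 ∧ t 0 < c.x}

/-- `T` is semialgebraic. -/
theorem isSemialgebraic_hiDom : IsSemialgebraic ℚ (hiDom a c) := by
  have h2 := isSemialgebraic_sep_lt_apply isSemialgebraic_wedge 1 (c.twist a).alg
  convert isSemialgebraic_sep_apply_lt h2 0 c.alg using 1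
  ext t; simp only [hiDom, mem_setOf_eq]
  constructor
  · rintro ⟨h1, h2, h3⟩; exact ⟨⟨⟨((c.twist a).pos).trans h1, h2⟩, h1⟩, h3⟩
  · rintro ⟨⟨⟨-, h2⟩, h1⟩, h3⟩; exact ⟨h1, h2, h3⟩

/-- `M` is semialgebraic. -/
theorem isSemialgebraic_midRect : IsSemialgebraic ℚ (midRect a c) := by
  have h1 : IsSemialgebraic ℚ {t : Fin 2 → ℝ | 0 < t 1} := by
    simpa using isSemialgebraic_setOf_eval_pos (k := ℚ) (R := ℝ) (X 1 : MvPolynomial (Fin 2) ℚ)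
  have h2 := isSemialgebraic_sep_apply_lt h1 1 (c.twist a).alg
  have h3 := isSemialgebraic_sep_lt_apply h2 0 (c.twist a).alg
  convert isSemialgebraic_sep_apply_lt h3 0 c.alg using 1
  ext t; simp only [midRect, mem_setOf_eq]; tauto

/-- `T ⊆ D(y)`. -/
theorem hiDom_subset : hiDom a c ⊆ cutDom c := fun _ ⟨h1, h2, h3⟩ =>
  ⟨(c.twist a).pos.trans h1, h2, h3⟩

/-- `M ⊆ D(y)`. -/
theorem midRect_subset : midRect a c ⊆ cutDom c := fun _ ⟨h1, h2, h3, h4⟩ =>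
  ⟨h1, h2.trans h3, h4⟩

/-- `D(y ⋆ x) ⊆ D(y)`. -/
theorem cutDom_twist_subset : cutDom (c.twist a) ⊆ cutDom c := fun _ ⟨h1, h2, h3⟩ =>
  ⟨h1, h2, h3.trans (Cut.twist_lt a c)⟩

/-- The upper triangle `T` with the dilogarithm form. -/
def hiRep : IntegralRep 2 :=
  ratRep (hiDom a c) dilogFun 1 (X 0 * (1 - X 1)) (isSemialgebraic_hiDom a c)
    (fun t ht => by simpa using dilogDen_ne_zero (cutDom_subset c (hiDom_subset a c ht)))
    (fun t _ => by simp [dilogFun])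
    (integrableOn_dilogFun ((hiDom_subset a c).trans (cutDom_subset c))
      (IsSemialgebraic.measurableSet_holds (isSemialgebraic_hiDom a c)))

/-- The rectangle `M` with the dilogarithm form. -/
def midRep : IntegralRep 2 :=
  ratRep (midRect a c) dilogFun 1 (X 0 * (1 - X 1)) (isSemialgebraic_midRect a c)
    (fun t ht => by simpa using dilogDen_ne_zero (cutDom_subset c (midRect_subset a c ht)))
    (fun t _ => by simp [dilogFun])
    (integrableOn_dilogFun ((midRect_subset a c).trans (cutDom_subset c))
      (IsSemialgebraic.measurableSet_holds (isSemialgebraic_midRect a c)))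

/-! ## Move (1a): `D(y) = D(y ⋆ x) ⊔ M ⊔ T` up to two null lines -/

/-- **Dissection move.** `[D(y)] − [D(y ⋆ x)] − [M] − [T]` is a relation. -/
theorem dilogCut_dissect_twist :
    of (dilogCut c) - of (dilogCut (c.twist a)) - of (midRep a c) - of (hiRep a c) ∈ relations := by
  let R : Fin 3 → IntegralRep 2 := ![dilogCut (c.twist a), midRep a c, hiRep a c]
  have hR : ∀ i, (R i).domain ⊆ cutDom c ∧ (R i).integrand = dilogFun := by
    intro i; fin_cases i
    exacts [⟨cutDom_twist_subset a c, rfl⟩, ⟨midRect_subset a c, rfl⟩, ⟨hiDom_subset a c, rfl⟩]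
  have h := of_sub_sum_of_mem_relations (Finset.univ : Finset (Fin 3)) (dilogCut c) R
    (fun i _ => measure_mono_null (fun t ht => absurd ((hR i).1 ht.1) ht.2) measure_empty)
    (fun i _ t _ => by rw [(hR i).2]; rfl) ?_ ?_
  · have e : ∑ i : Fin 3, of (R i) =
        of (dilogCut (c.twist a)) + of (midRep a c) + of (hiRep a c) := by
      rw [Fin.sum_univ_three]; rfl
    rw [e] at h; convert h using 1; abel
  · have hc : ∀ i : Fin 2, volume {t : Fin 2 → ℝ | t i = (c.twist a).x} = 0 := fun i => by
      rw [volume_pi]; exact Measure.pi_hyperplane (fun _ : Fin 2 => (volume : Measure ℝ)) i _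
    refine measure_mono_null (fun t ht => ?_) (measure_union_null (hc 0) (hc 1))
    obtain ⟨ht, hn⟩ := ht
    change t ∈ cutDom c at ht
    simp only [mem_iUnion, Finset.mem_univ, exists_true_left, not_exists] at hn
    have h0 : t ∉ cutDom (c.twist a) := hn 0
    have h1 : t ∉ midRect a c := hn 1
    have h2 : t ∉ hiDom a c := hn 2
    simp only [cutDom, midRect, hiDom, mem_setOf_eq, not_and, not_lt] at ht h0 h1 h2
    by_contra hne
    simp only [mem_union, mem_setOf_eq, not_or] at hne
    rcases lt_or_gt_of_ne hne.1 with ha | ha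
    · rcases lt_or_gt_of_ne hne.2 with hb | hb
      · exact absurd (h0 ht.1 ht.2.1) (not_le.2 ha)
      · linarith [ht.2.1]
    · rcases lt_or_gt_of_ne hne.2 with hb | hb
      · exact absurd (h1 ht.1 hb ha) (not_le.2 ht.2.2)
      · exact absurd (h2 hb ht.2.1) (not_le.2 ht.2.2)
  · intro i _ j _ hij
    have key : ∀ i j, i < j → volume ((R i).domain ∩ (R j).domain) = 0 := by
      intro i j hlt
      rw [show (R i).domain ∩ (R j).domain = ∅ from ?_, measure_empty]
      ext t
      simp only [mem_inter_iff, mem_empty_iff_false, iff_false, not_and]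
      intro hi hj
      fin_cases i <;> fin_cases j <;> simp at hlt
      · change t ∈ cutDom (c.twist a) at hi; change t ∈ midRect a c at hj
        simp only [cutDom, midRect, mem_setOf_eq] at hi hj; linarith [hi.2.1]
      · change t ∈ cutDom (c.twist a) at hi; change t ∈ hiDom a c at hj
        simp only [cutDom, hiDom, mem_setOf_eq] at hi hj; linarith [hi.2.2]
      · change t ∈ midRect a c at hi; change t ∈ hiDom a c at hj
        simp only [midRect, hiDom, mem_setOf_eq] at hi hj; linarith [hi.1]
    rcases lt_or_gt_of_ne hij with hlt | hlt
    · exact key i j hlt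
    · rw [inter_comm]; exact key j i hlt

/-! ## Move (2): the rectangle `M` is a logarithmic box -/

/-- The affine chart of `D(f)`'s rectangle maps `M` onto the box of `y/f` and `1/(1−f)`. -/
theorem image_cutChart_midRect : cutChart (c.twist a) '' midRect a c =
    logBoxDom ((c.twist a).x⁻¹ * c.x) (1 - (c.twist a).x)⁻¹ := by
  have hf := (c.twist a).pos
  have hf1 := (c.twist a).symm_pos
  have i1 : (c.twist a).x⁻¹ * (c.twist a).x = 1 := inv_mul_cancel₀ hf.ne'
  have i2 : (1 - (c.twist a).x)⁻¹ * (1 - (c.twist a).x) = 1 := inv_mul_cancel₀ hf1.ne'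
  ext u
  simp only [mem_image, midRect, logBoxDom, mem_setOf_eq]
  constructor
  · rintro ⟨t, ⟨h1, h2, h3, h4⟩, rfl⟩
    simp only [cutChart, Matrix.cons_val_zero, Matrix.cons_val_one]
    refine ⟨?_, ?_, ?_, ?_⟩
    · rw [lt_inv_mul_iff₀ hf, mul_one]; exact h3
    · exact mul_lt_mul_of_pos_left h4 (inv_pos.2 hf)
    · rw [lt_inv_mul_iff₀ hf1, mul_one]; linarith
    · exact mul_lt_of_lt_one_right (inv_pos.2 hf1) (by linarith)
  · rintro ⟨h1, h2, h3, h4⟩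
    have h5 : (1 - (c.twist a).x) * u 1 < 1 := by
      have h := mul_lt_mul_of_pos_left h4 hf1
      rwa [mul_inv_cancel₀ hf1.ne'] at h
    refine ⟨![(c.twist a).x * u 0, 1 - (1 - (c.twist a).x) * u 1], ⟨?_, ?_, ?_, ?_⟩, ?_⟩
    · show 0 < 1 - (1 - (c.twist a).x) * u 1
      linarith
    · show 1 - (1 - (c.twist a).x) * u 1 < (c.twist a).x
      nlinarith [mul_pos hf1 (sub_pos.2 h3)]
    · show (c.twist a).x < (c.twist a).x * u 0
      exact lt_mul_of_one_lt_right hf h1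
    · show (c.twist a).x * u 0 < c.x
      have h := mul_lt_mul_of_pos_left h2 hf
      rwa [← mul_assoc, mul_inv_cancel₀ hf.ne', one_mul] at h
    · funext i
      fin_cases i
      · show (c.twist a).x⁻¹ * ((c.twist a).x * u 0) = u 0
        rw [← mul_assoc, i1, one_mul]
      · show (1 - (c.twist a).x)⁻¹ * (1 - (1 - (1 - (c.twist a).x) * u 1)) = u 1
        rw [sub_sub_cancel, ← mul_assoc, i2, one_mul]

/-- **Chart move.** `[M] ≡` the logarithmic box of `y/f`, `1/(1−f)`. -/
theorem midRep_equiv_logBox : Equivalent (midRep a c)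
    (logBox ((c.twist a).alg_inv.mul c.alg) (c.twist a).symm.alg_inv) := by
  have hS := isSemialgebraic_midRect a c
  refine equivalent_of_chart ?_ (fun t _ => hasFDerivAt_cutChart (c.twist a) t)
    (injective_cutChart (c.twist a)).injOn (image_cutChart_midRect a c)
    (fun _ _ => abs_det_cutChartDeriv (c.twist a))
    (fun t _ => dilogFun_eq_logSqFun_cutChart (c.twist a) t) rfl (fun _ _ => rfl)
    (by simp [logBox, ratRep]) (fun _ _ => rfl)
  refine IsSemialgebraicMapOn.of_forall hS fun i => ?_
  fin_cases i
  · exact (IsSemialgebraicFunOn.mul_holds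
      (isSemialgebraicFunOn_const_of_isAlgebraic hS (c.twist a).alg_inv)
      (isSemialgebraicFunOn_aeval hS (X 0))).congr fun t _ => by simp [cutChart]
  · exact (IsSemialgebraicFunOn.mul_holds
      (isSemialgebraicFunOn_const_of_isAlgebraic hS (c.twist a).symm.alg_inv)
      (isSemialgebraicFunOn_aeval hS (1 - X 1))).congr fun t _ => by simp [cutChart]

/-- **`[M] = ℓ(y/f)·ℓ(1/(1−f))`** in `Q`. -/
theorem mkQ_midRep : mkQ (of (midRep a c)) =
    ell ((c.twist a).x⁻¹ * c.x) * ell ((1 - (c.twist a).x)⁻¹) := by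
  have h := mkQ_logBox ((c.twist a).alg_inv.mul c.alg) (c.twist a).symm.alg_inv
  rw [← mkQ_eq_mkQ_iff.2 (midRep_equiv_logBox a c)] at h
  exact h

end SoloBlind

end Summit.KontsevichZagierPeriods.KontsevichZagierPeriods.Theorems
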